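import Literature.MathematicalPhysics.QuantumFieldTheory.Balaban1983to89.B9Eq3132NuReading
import Literature.MathematicalPhysics.QuantumFieldTheory.Balaban1983to89.B9Thm311SymmAtRecordV4
import Literature.MathematicalPhysics.QuantumFieldTheory.Balaban1983to89.B9CoReadingCoordsTranspose
import Literature.MathematicalPhysics.QuantumFieldTheory.Balaban1983to89.QGQInverse

/-!
# `Balaban1983to89.B9Eq3132CoerciveVariational` — T. Bałaban, *Propagators for lattice gauge theories in a background field*, Commun. Math. Phys. **99** (1985)
# 389–434 [Balaban1985BackgroundPropagators], (3.132) p. 422 with [4] (2.147) p. 249: THE VARIATIONAL PRINCIPLE FOR THE Λ²-COERCIVITY OF `Q G(U) Q*` IN THE TRACE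
# CURRENCY OF def-Y's LETTERS — `CoerciveUnder` for the normalised `Q G₀(U) Q*` (`G₀ = Δ_a(U)⁻¹`, the Sect. A–C propagator) FROM Theorem 3.11's positivity of
# `Δ_a(U)` (ROW 17's displayed clause) AND A TEST FAMILY (approximate right inverse of `Q(U)` + energy bound)

[4] = T. Bałaban, *Propagators and renormalization transformations for lattice gauge theories. II*, Commun. Math. Phys. **96** (1984) 223–250 [`Balaban1984PropagatorsII`].

statement-level skeleton of published theorems with citation tags; proofs where landed; nothing here is a claim about the Yang–Mills mass gap

THE PRINT.  [4] p. 249: *«⟨λ, QGQ*λ⟩ ≥ γ₀ Σ_{y∈𝔅} Λ_y²|λ(y)|² (2.147) … This follows from (2.145), (2.146) and Lemma 2.4»* (the lower bound behind Prop. 2.7 ∕ (2.149));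
[B9] p. 416, Theorem 3.11: *«the operators Δ′_a, G′, (Q′G′²Q′\*)⁻¹, Δ_a, G are positive definite … It is a symmetric and invertible operator»*; p. 422 (3.132) and
p. 421 *«G₀ = (Δ + DRD* + Q*aQ)⁻¹»*; p. 393 (Q* the adjoint of Q).  The device (cell's written repair `QGQ-inverse-proof.md` §5.1, kernel companion
`QGQInverse.two_dot_sub_form_le_inv_form ∕ qgq_coercive_of_approx_right_inverse` for real matrices): for a symmetric positive `Δ` with inverse `G`,
`2⟨A, μ⟩ − ⟨A, ΔA⟩ ≤ ⟨μ, Gμ⟩` for EVERY test field `A`; with `μ = Q*λ` an approximate right inverse `T` of `Q` (`⟨QTλ, λ⟩ ≥ (1−θ)‖λ‖²`) with energy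
`⟨Tλ, ΔTλ⟩ ≤ C‖λ‖²` certifies `⟨λ, QGQ*λ⟩ ≥ ((1−θ)²∕C)‖λ‖²`.

WHY THIS FILE (dag-n06-i gen 13, N06 bundle F4, row 26).  The sibling `B9Eq3132CoerciveFromGA` reduces row 26's two coercivity binders to ONE, `hcoA` =
`CoerciveUnder … (fun x U => normMatY b (lamInvY x.toKIdx) (QGQOfY x.toKIdx (parBY x.toKIdx) (lettersYOfRecordV4 …).GA U))` — Λ²-coercivity of the NORMALISED
REAL MATRIX of `Q G₀(U) Q*` in a real basis `b` of `M_N(ℂ)`.  THIS FILE turns that matrix statement into print's operator statement and proves the variational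
principle AT def-Y's GENUINE LETTERS: in the trace basis `trBasis N` (orthonormal for `Re tr(X\*Y)`: `trBasis_repr_eq_trace`) the quadratic form of
`normMatY b w (Q ∘ G ∘ Qs)` IS `κ′⁻¹·Re tr⟨wΨ, Q G Qs (wΨ)⟩` (Parseval, §1), and for `Δ` symmetric (`IsSymmTr 1`) and positive (`PosDefTr 1` — row 17's displayed
`hΔA` at the record), `G = Ring.inverse Δ`, `Qs` the trace-adjoint of `Q` (n06-j `isAdjTr_QY_QsY_parBY`), ANY test map `T` with the two printed-definition-level
estimates (P′2) `(1−θ)‖Ψ‖² ≤ Re tr⟨Q(TΨ), wΨ⟩` and (P′1) `Re tr⟨TΨ, Δ(TΨ)⟩ ≤ C‖Ψ‖²` gives `Coercive (normMatY b w (Q ∘ G ∘ Qs)) ((1−θ)²∕(Cκ′))` (§2–§3).  §4 is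
the family statement at the v4 record: `hcoA` FROM `hΔA` + a test family.  With the explicit block test fields of the written repair's Lemma P′ (far-layer tents
transported by def-Y's own taxicab `parBY`, so that `Q(U)T` has NO holonomy error on the diagonal) (P′2) is flat combinatorics of the averaging weights and (P′1)
an elementary energy estimate under (3.35) — typed next; here `T` is a parameter.

WHAT IS PROVED (sorry-free).
* §1 trace-orthonormal coordinates (gen 4's product basis `piBasisY b`): `sum_repr_mul_repr` (Parseval in a basis with `repr_c v = Re tr((b c)ᴴv)`),
  `dot_piRepr` (`= trIP 1`), `reMatY_mulVec_piRepr`, `piRepr_symm`, `piRepr_smul`, `dot_normMatY_mulVec` (the form of `normMatY b w T` IS `κ′⁻¹·trIP 1 (wΨ) (T(wΨ))`).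
* §2 the pairing's algebra (`trIP_comm`, `trIP_sub_right`, `trIP_smul_right`, left versions) and ★ `two_trIP_sub_le_trIP_inverse` (`2⟨A, μ⟩ − ⟨A, ΔA⟩ ≤ ⟨μ, Gμ⟩`
  for `Δ` trace-symmetric, positive, `G = Ring.inverse Δ`).
* §3 ★★ `coercive_normMatY_of_testOp` (one configuration: `Coercive (normMatY b w (Q ∘ₗ Ring.inverse Δ ∘ₗ Qs)) ((1−θ)²∕(C·κ′(b)))` from symmetry, positivity,
  adjointness and (P′1)∕(P′2) for a test map).
* §4 ★★★ `hcoA_of_testFamily` — at def-Y's v4 record (`𝔸 = M_N(ℂ)`, `G = SU(N)`, `b = trBasis N`): `hcoA` (the sibling's ONE coercivity binder, `w = Λ⁻¹ = lamInvY`)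
  from ROW 17's displayed positivity clause `hΔA : … → PosDefTr 1 (deltaAY … U)` and a test family with uniform `θ < 1`, `C > 0` under Theorem 3.12's prefix;
  the symmetry of `Δ_a(U)` (n06-j `deltaAY_isSymmTr` ∕ `symm0_parSymY` ∕ `adj_parSymY`) and (3.13) (`isAdjTr_QY_QsY_parBY`) are theorems.

HONEST SCOPE.  Finite-dimensional real linear algebra over landed objects; the test family and its two estimates are HYPOTHESES here (the written repair's
Lemma P′, elementary but not yet typed at def-Y's letters); row 17's `hΔA` (Theorem 3.11's positivity of `Δ_a(U)` on (3.35)) stays displayed; nothing of [B9] or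
[4] is asserted; count-neutral; N06 NOT discharged; nothing continuum, nothing OS, nothing about the mass gap.  Cell `pub-ymgap` (HUMAN RULING D-0062), Track A
node N06 [B9], seat `pub-ymgap-dag-n06-i` (gen 13), 2026-08-27; a NEW file.
-/

noncomputable section

namespace Literature.MathematicalPhysics.QuantumFieldTheory.Balaban1983to89.B9Eq3132CoerciveVariational

open B9Thm311ReadingCoords (trIP trIP_eq_re_trace PosDefTr IsSymmTr IsAdjTr isUnit_of_posDefTr apply_inverse_of_isUnit)
open B9CoReadingCoordsTranspose (TrIdx trBasis trBasis_repr_eq_trace trReForm trReForm_apply trReForm_symm sum_trReForm_eq_trIP)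
open B9Eq3132RingInverseReading (piBasisY piBasisY_repr reMatY normMatY dimConstY' dimConstY'_pos)
open QGQInverse (Coercive)
open Matrix
open scoped Matrix.Norms.L2Operator

variable {N : ℕ}

/-! ## §1 Trace-orthonormal coordinates: Parseval, the matrix action, the form of `normMatY` -/

section Coords

variable {κ : Type} [Fintype κ] [DecidableEq κ] {X : Type} [Fintype X] [DecidableEq X]

omit [DecidableEq κ] in
/-- **PARSEVAL** in a real basis `b` of `M_N(ℂ)` orthonormal for the trace pairing (`repr_c v = Re tr((b c)ᴴ v)`, e.g. `trBasis N`):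
`Σ_c repr_c v · repr_c w = Re tr(vᴴ w)`. [cite: Balaban1985BackgroundPropagators, p.393 (scalar products), bookkeeping] -/
theorem sum_repr_mul_repr (b : Module.Basis κ ℝ (Matrix (Fin N) (Fin N) ℂ))
    (hb : ∀ (v : Matrix (Fin N) (Fin N) ℂ) (c : κ), b.repr v c = (Matrix.trace ((b c)ᴴ * v)).re) (v w : Matrix (Fin N) (Fin N) ℂ) :
    ∑ c, b.repr v c * b.repr w c = (Matrix.trace (vᴴ * w)).re := by
  have h1 : ∀ c, b.repr v c * b.repr w c = (Matrix.trace ((b.repr v c • b c)ᴴ * w)).re := by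
    intro c
    rw [hb w c, Matrix.conjTranspose_smul, star_trivial, Matrix.smul_mul, Matrix.trace_smul, Complex.smul_re, smul_eq_mul]
  rw [Finset.sum_congr rfl fun c _ => h1 c, ← Complex.re_sum, ← Matrix.trace_sum, ← Finset.sum_mul, ← Matrix.conjTranspose_sum,
    b.sum_repr v]

omit [DecidableEq κ] [DecidableEq X] in
/-- **PARSEVAL ON THE CARRIER**: the dot product of the coordinates IS the weight-one trace pairing `trIP 1`. [cite: Balaban1985BackgroundPropagators, p.393 (scalar products), bookkeeping] -/
theorem dot_piRepr (b : Module.Basis κ ℝ (Matrix (Fin N) (Fin N) ℂ))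
    (hb : ∀ (v : Matrix (Fin N) (Fin N) ℂ) (c : κ), b.repr v c = (Matrix.trace ((b c)ᴴ * v)).re) (Φ Ψ : X → Matrix (Fin N) (Fin N) ℂ) :
    ⇑((piBasisY (X := X) b).repr Φ) ⬝ᵥ ⇑((piBasisY (X := X) b).repr Ψ) = trIP (fun _ => (1 : ℝ)) Φ Ψ := by
  rw [dotProduct, Fintype.sum_prod_type, trIP_eq_re_trace]
  refine Finset.sum_congr rfl fun x _ => ?_
  simp only [piBasisY_repr, one_mul]
  exact sum_repr_mul_repr b hb (Φ x) (Ψ x)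

/-- the real matrix of a letter acts on coordinates as the letter acts on functions. [cite: Balaban1985BackgroundPropagators, (3.132) p.422, bookkeeping] -/
theorem reMatY_mulVec_piRepr (b : Module.Basis κ ℝ (Matrix (Fin N) (Fin N) ℂ))
    (T : (X → Matrix (Fin N) (Fin N) ℂ) →ₗ[ℂ] (X → Matrix (Fin N) (Fin N) ℂ)) (Φ : X → Matrix (Fin N) (Fin N) ℂ) :
    reMatY b T *ᵥ ⇑((piBasisY (X := X) b).repr Φ) = ⇑((piBasisY (X := X) b).repr (T Φ)) := by
  unfold reMatY
  exact LinearMap.toMatrix_mulVec_repr (piBasisY (X := X) b) (piBasisY (X := X) b) (T.restrictScalars ℝ) Φ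

omit [DecidableEq κ] [DecidableEq X] in
/-- every coordinate vector is the coordinate vector of a function. [cite: Balaban1985BackgroundPropagators, (3.132) p.422, bookkeeping] -/
theorem piRepr_symm (b : Module.Basis κ ℝ (Matrix (Fin N) (Fin N) ℂ)) (v : X × κ → ℝ) :
    ⇑((piBasisY (X := X) b).repr ((piBasisY (X := X) b).equivFun.symm v)) = v := by
  funext a
  rw [← Module.Basis.equivFun_apply, LinearEquiv.apply_symm_apply]

omit [Fintype κ] [DecidableEq κ] [DecidableEq X] in
/-- coordinates of a sitewise real rescaling. [cite: Balaban1985BackgroundPropagators, (3.132) p.422, bookkeeping] -/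
theorem piRepr_smul (b : Module.Basis κ ℝ (Matrix (Fin N) (Fin N) ℂ)) (w : X → ℝ) (Ψ : X → Matrix (Fin N) (Fin N) ℂ) (a : X × κ) :
    (piBasisY (X := X) b).repr (fun x => w x • Ψ x) a = w a.1 * (piBasisY (X := X) b).repr Ψ a := by
  rw [piBasisY_repr, piBasisY_repr, map_smul, Finsupp.smul_apply, smul_eq_mul]

/-- ★ **THE QUADRATIC FORM OF THE NORMALISED MATRIX IS THE TRACE FORM OF THE LETTER ON RESCALED FUNCTIONS**: for `Ψ` with coordinates `v`,
`v·(normMatY b w T)v = κ′(b)⁻¹ · trIP 1 (wΨ) (T(wΨ))`. [cite: Balaban1985BackgroundPropagators, (3.132) p.422; Balaban1984PropagatorsII, (2.147) p.249 (dictionary)] -/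
theorem dot_normMatY_mulVec (b : Module.Basis κ ℝ (Matrix (Fin N) (Fin N) ℂ))
    (hb : ∀ (v : Matrix (Fin N) (Fin N) ℂ) (c : κ), b.repr v c = (Matrix.trace ((b c)ᴴ * v)).re) (w : X → ℝ)
    (T : (X → Matrix (Fin N) (Fin N) ℂ) →ₗ[ℂ] (X → Matrix (Fin N) (Fin N) ℂ)) (Ψ : X → Matrix (Fin N) (Fin N) ℂ) :
    ⇑((piBasisY (X := X) b).repr Ψ) ⬝ᵥ (normMatY b w T *ᵥ ⇑((piBasisY (X := X) b).repr Ψ)) =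
      (dimConstY' b)⁻¹ * trIP (fun _ => (1 : ℝ)) (fun x => w x • Ψ x) (T (fun x => w x • Ψ x)) := by
  have hu : (Matrix.diagonal fun a : X × κ => w a.1) *ᵥ ⇑((piBasisY (X := X) b).repr Ψ) =
      ⇑((piBasisY (X := X) b).repr (fun x => w x • Ψ x)) := by
    funext a; rw [mulVec_diagonal, piRepr_smul]
  rw [normMatY, ← mulVec_mulVec, ← mulVec_mulVec, hu, reMatY_mulVec_piRepr, ← dot_piRepr b hb]
  rw [dotProduct, dotProduct, Finset.mul_sum]
  refine Finset.sum_congr rfl fun a _ => ?_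
  rw [mulVec_diagonal, piRepr_smul]
  ring

end Coords

/-! ## §2 The pairing's algebra and the variational inequality `2⟨A, μ⟩ − ⟨A, ΔA⟩ ≤ ⟨μ, Gμ⟩` -/

section Variational

variable {S : Type} [Fintype S]

/-- the weight-one trace pairing is symmetric. [cite: Balaban1985BackgroundPropagators, p.393 (scalar products), bookkeeping] -/
theorem trIP_comm (Φ Ψ : S → Matrix (Fin N) (Fin N) ℂ) : trIP (fun _ => (1 : ℝ)) Φ Ψ = trIP (fun _ => (1 : ℝ)) Ψ Φ := by
  rw [← sum_trReForm_eq_trIP, ← sum_trReForm_eq_trIP]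
  exact Finset.sum_congr rfl fun x _ => trReForm_symm _ _

/-- the pairing is subtractive on the right. [cite: Balaban1985BackgroundPropagators, p.393 (scalar products), bookkeeping] -/
theorem trIP_sub_right (w : S → ℝ) (Φ Ψ₁ Ψ₂ : S → Matrix (Fin N) (Fin N) ℂ) : trIP w Φ (Ψ₁ - Ψ₂) = trIP w Φ Ψ₁ - trIP w Φ Ψ₂ := by
  simp only [trIP, Pi.sub_apply, Matrix.sub_apply, mul_sub, Complex.sub_re, Finset.sum_sub_distrib]

/-- the pairing is real-homogeneous on the right. [cite: Balaban1985BackgroundPropagators, p.393 (scalar products), bookkeeping] -/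
theorem trIP_smul_right (w : S → ℝ) (r : ℝ) (Φ Ψ : S → Matrix (Fin N) (Fin N) ℂ) : trIP w Φ (r • Ψ) = r * trIP w Φ Ψ := by
  simp only [trIP, Pi.smul_apply, Matrix.smul_apply, Complex.real_smul, Finset.mul_sum]
  refine Finset.sum_congr rfl fun s _ => Finset.sum_congr rfl fun a _ => Finset.sum_congr rfl fun c _ => ?_
  rw [← mul_assoc (star _), mul_comm (star _) (r : ℂ), mul_assoc, Complex.re_ofReal_mul]
  ring

/-- the weight-one pairing is subtractive on the left. [cite: Balaban1985BackgroundPropagators, p.393 (scalar products), bookkeeping] -/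
theorem trIP_sub_left (Φ₁ Φ₂ Ψ : S → Matrix (Fin N) (Fin N) ℂ) :
    trIP (fun _ => (1 : ℝ)) (Φ₁ - Φ₂) Ψ = trIP (fun _ => (1 : ℝ)) Φ₁ Ψ - trIP (fun _ => (1 : ℝ)) Φ₂ Ψ := by
  rw [trIP_comm, trIP_sub_right, trIP_comm Ψ, trIP_comm Ψ]

/-- the weight-one pairing is real-homogeneous on the left. [cite: Balaban1985BackgroundPropagators, p.393 (scalar products), bookkeeping] -/
theorem trIP_smul_left (r : ℝ) (Φ Ψ : S → Matrix (Fin N) (Fin N) ℂ) :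
    trIP (fun _ => (1 : ℝ)) (r • Φ) Ψ = r * trIP (fun _ => (1 : ℝ)) Φ Ψ := by
  rw [trIP_comm, trIP_smul_right, trIP_comm Ψ]

/-- ★ **THE VARIATIONAL INEQUALITY IN TRACE CURRENCY**: for `Δ` trace-symmetric and positive definite (so a unit, `G := Ring.inverse Δ` its two-sided inverse) and
EVERY test field `A` and every `μ`: `2⟨A, μ⟩ − ⟨A, ΔA⟩ ≤ ⟨μ, Gμ⟩` (expand `0 ≤ ⟨A − Gμ, Δ(A − Gμ)⟩`).  The twin of `QGQInverse.two_dot_sub_form_le_inv_form` for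
def-Y's ℂ-linear letters and print's scalar product. [cite: Balaban1985BackgroundPropagators, Thm 3.11 p.416 («positive definite … symmetric and invertible»); Balaban1984PropagatorsII, (2.145)–(2.147) p.249] -/
theorem two_trIP_sub_le_trIP_inverse (Δ : (S → Matrix (Fin N) (Fin N) ℂ) →ₗ[ℂ] (S → Matrix (Fin N) (Fin N) ℂ))
    (hsymm : IsSymmTr (fun _ => (1 : ℝ)) Δ) (hpos : PosDefTr (fun _ => (1 : ℝ)) Δ) (A μ : S → Matrix (Fin N) (Fin N) ℂ) :
    2 * trIP (fun _ => (1 : ℝ)) A μ - trIP (fun _ => (1 : ℝ)) A (Δ A) ≤ trIP (fun _ => (1 : ℝ)) μ (Ring.inverse Δ μ) := by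
  set v := Ring.inverse Δ μ with hv
  have hΔv : Δ v = μ := apply_inverse_of_isUnit (isUnit_of_posDefTr hpos) μ
  have h0 : 0 ≤ trIP (fun _ => (1 : ℝ)) (A - v) (Δ (A - v)) := by
    by_cases h : A - v = 0
    · rw [h, map_zero, B9Thm311ReadingCoords.trIP_zero_right]
    · exact (hpos _ h).le
  have e1 : trIP (fun _ => (1 : ℝ)) v (Δ A) = trIP (fun _ => (1 : ℝ)) A μ := by
    rw [← hsymm v A, hΔv, trIP_comm]
  rw [map_sub, hΔv, trIP_sub_left, trIP_sub_right, trIP_sub_right, e1, trIP_comm v μ] at h0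
  linarith

end Variational

/-! ## §3 ★★ One configuration: coercivity of the normalised `Q G Qs` from symmetry, positivity, adjointness and a test map -/

section OneU

variable {κ : Type} [Fintype κ] [DecidableEq κ] {I F : Type} [Fintype I] [DecidableEq I] [Fintype F]

/-- ★★ **COERCIVITY OF THE NORMALISED `Q G Q*` FROM A TEST MAP** (one configuration): `Δ` trace-symmetric and positive definite on `F → M_N(ℂ)`, `G = Ring.inverse Δ`,
`Qs` the trace-adjoint of `Q : (F → M_N(ℂ)) → (I → M_N(ℂ))`, `b` trace-orthonormal, `w : I → ℝ` the normalisation weights, and a test map `T` with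
(P′2) `(1−θ)·‖Ψ‖² ≤ Re tr⟨Q(TΨ), wΨ⟩` (approximate right inverse of `Q` against the weights) and (P′1) `Re tr⟨TΨ, Δ(TΨ)⟩ ≤ C‖Ψ‖²` (energy), `θ ≤ 1`, `C > 0`:
`Coercive (normMatY b w (Q ∘ G ∘ Qs)) ((1−θ)²∕(C·κ′(b)))` — the written repair's Lemma P′ shape, optimal amplitude `(1−θ)∕C`.
[cite: Balaban1984PropagatorsII, (2.147) p.249; Balaban1985BackgroundPropagators, (3.132) p.422, Thm 3.11 p.416, p.393 (Q* the adjoint of Q)] -/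
theorem coercive_normMatY_of_testOp (b : Module.Basis κ ℝ (Matrix (Fin N) (Fin N) ℂ))
    (hb : ∀ (v : Matrix (Fin N) (Fin N) ℂ) (c : κ), b.repr v c = (Matrix.trace ((b c)ᴴ * v)).re)
    (Δ : (F → Matrix (Fin N) (Fin N) ℂ) →ₗ[ℂ] (F → Matrix (Fin N) (Fin N) ℂ)) (hsymm : IsSymmTr (fun _ => (1 : ℝ)) Δ) (hpos : PosDefTr (fun _ => (1 : ℝ)) Δ)
    (Q : (F → Matrix (Fin N) (Fin N) ℂ) →ₗ[ℂ] (I → Matrix (Fin N) (Fin N) ℂ)) (Qs : (I → Matrix (Fin N) (Fin N) ℂ) →ₗ[ℂ] (F → Matrix (Fin N) (Fin N) ℂ))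
    (hadj : IsAdjTr (fun _ => (1 : ℝ)) (fun _ => (1 : ℝ)) Q Qs) (w : I → ℝ)
    (T : (I → Matrix (Fin N) (Fin N) ℂ) → (F → Matrix (Fin N) (Fin N) ℂ)) {θ C : ℝ} (hθ : θ ≤ 1) (hC : 0 < C)
    (hP2 : ∀ Ψ : I → Matrix (Fin N) (Fin N) ℂ, (1 - θ) * trIP (fun _ => (1 : ℝ)) Ψ Ψ ≤ trIP (fun _ => (1 : ℝ)) (Q (T Ψ)) (fun y => w y • Ψ y))
    (hP1 : ∀ Ψ : I → Matrix (Fin N) (Fin N) ℂ, trIP (fun _ => (1 : ℝ)) (T Ψ) (Δ (T Ψ)) ≤ C * trIP (fun _ => (1 : ℝ)) Ψ Ψ) :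
    Coercive (normMatY b w (Q ∘ₗ Ring.inverse Δ ∘ₗ Qs)) ((1 - θ) ^ 2 / (C * dimConstY' b)) := by
  intro v
  set Ψ : I → Matrix (Fin N) (Fin N) ℂ := (piBasisY (X := I) b).equivFun.symm v with hΨ
  have hv : ⇑((piBasisY (X := I) b).repr Ψ) = v := piRepr_symm b v
  rw [← hv, dot_normMatY_mulVec b hb, dot_piRepr b hb]
  set wΨ : I → Matrix (Fin N) (Fin N) ℂ := fun y => w y • Ψ y with hwΨ
  set μ : F → Matrix (Fin N) (Fin N) ℂ := Qs wΨ with hμ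
  have hκ := dimConstY'_pos b
  -- the variational inequality with the test field `s • TΨ`, `s = (1 − θ)/C`
  set s : ℝ := (1 - θ) / C with hs
  have hvar := two_trIP_sub_le_trIP_inverse Δ hsymm hpos (s • T Ψ) μ
  have e1 : trIP (fun _ => (1 : ℝ)) (s • T Ψ) μ = s * trIP (fun _ => (1 : ℝ)) (Q (T Ψ)) wΨ := by
    rw [trIP_smul_left, hμ, ← hadj]
  have e2 : trIP (fun _ => (1 : ℝ)) (s • T Ψ) (Δ (s • T Ψ)) = s ^ 2 * trIP (fun _ => (1 : ℝ)) (T Ψ) (Δ (T Ψ)) := by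
    rw [LinearMap.map_smul_of_tower, trIP_smul_left, trIP_smul_right]; ring
  have e3 : trIP (fun _ => (1 : ℝ)) μ (Ring.inverse Δ μ) = trIP (fun _ => (1 : ℝ)) wΨ ((Q ∘ₗ Ring.inverse Δ ∘ₗ Qs) wΨ) := by
    rw [LinearMap.comp_apply, LinearMap.comp_apply, trIP_comm wΨ, hadj, ← hμ, trIP_comm]
  rw [e1, e2, e3] at hvar
  have h1 := hP2 Ψ
  have h2 := hP1 Ψ
  have hΨΨ : 0 ≤ trIP (fun _ => (1 : ℝ)) Ψ Ψ := by
    rw [← dot_piRepr b hb]; exact Literature.LinearAlgebra.Matrix.dotProduct_self_nonneg_real _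
  have hs0 : 0 ≤ s := div_nonneg (by linarith) hC.le
  have h1' : s * ((1 - θ) * trIP (fun _ => (1 : ℝ)) Ψ Ψ) ≤ s * trIP (fun _ => (1 : ℝ)) (Q (T Ψ)) wΨ := mul_le_mul_of_nonneg_left h1 hs0
  have h2' : s ^ 2 * trIP (fun _ => (1 : ℝ)) (T Ψ) (Δ (T Ψ)) ≤ s ^ 2 * (C * trIP (fun _ => (1 : ℝ)) Ψ Ψ) := mul_le_mul_of_nonneg_left h2 (sq_nonneg _)
  have e4 : (1 - θ) ^ 2 / (C * dimConstY' b) * trIP (fun _ => (1 : ℝ)) Ψ Ψ =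
      (dimConstY' b)⁻¹ * (2 * (s * ((1 - θ) * trIP (fun _ => (1 : ℝ)) Ψ Ψ)) - s ^ 2 * (C * trIP (fun _ => (1 : ℝ)) Ψ Ψ)) := by
    rw [hs]; field_simp; ring
  rw [e4]
  exact mul_le_mul_of_nonneg_left (by linarith) (inv_nonneg.mpr hκ.le)

end OneU

/-! ## §4 ★★★ At def-Y's v4 record: `hcoA` from ROW 17's positivity clause and a test family -/

section Record

open Node00
open B6KLevelCensusIndexV1 (KIdx)
open B9PinMembersKLevelV1 (MemberY geo9Y bg9Y)
open B7Prop2SpecialUnitary (specialUnitaryUnits specialUnitaryUnits_le_unitaryUnits)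
open B9Thm311Curv2Symm (deltaAY_isSymmTr)
open B9Thm311SymmAtRecordV4 (symm0_parSymY adj_parSymY)
open B9Thm311AdjointPairs (isAdjTr_QY_QsY_parBY)
open B9Eq3132NuReading (lamInvY)
open B9Eq3132CTInputs (CoerciveUnder)
open B9Eq3132ScalarIndex (geoComap)
open scoped Matrix.Norms.L2Operator

/-- ★★★ **`hcoA` FROM THEOREM 3.11's POSITIVITY OF `Δ_a(U)` AND A TEST FAMILY** at def-Y's v4 record (`𝔸 = M_N(ℂ)`, `G = SU(N)`, trace basis `trBasis N`,
weights `Λ⁻¹`): if on Theorem 3.12's prefix (i) `Δ_a(U)` is positive definite for the trace pairing — ROW 17's displayed clause `hΔA` (its own prefix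
`M₃₁₁ ≤ M`, `Mα₀ ≤ a₃₁₁`, (3.35)) — and (ii) a test family `T x U` satisfies (P′2) `(1−θ)‖Ψ‖² ≤ Re tr⟨Q(U)(TΨ), Λ⁻¹Ψ⟩` and (P′1) `Re tr⟨TΨ, Δ_a(U)(TΨ)⟩ ≤ C‖Ψ‖²`
with uniform `θ < 1`, `C > 0`, then the sibling's ONE row-26 coercivity binder holds:
`CoerciveUnder … (fun x U => normMatY (trBasis N) (lamInvY x.toKIdx) (QGQOfY x.toKIdx (parBY x.toKIdx) (lettersYOfRecordV4 N θ M⋆ 𝔯 x).GA U))` with constant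
`(1−θ)²∕(C·κ′)`.  The symmetry of `Δ_a(U)` and (3.13) are n06-j's theorems. [cite: Balaban1984PropagatorsII, (2.147) p.249; Balaban1985BackgroundPropagators, (3.132) p.422, Thm 3.11 p.416, Thm 3.12 p.423 (prefix), (3.26)–(3.27) p.395, (3.13) p.393] -/
theorem hcoA_of_testFamily (θ : Stage3Params) (Mstar : ℕ) (𝔯 : ResY N θ Mstar)
    [∀ x : MemberY θ.d₆ θ.ℓ₆ θ.hd' θ.hL' θ.b₀ θ.b₁ Mstar, Fintype (geo9Y x).Site]
    [∀ x : MemberY θ.d₆ θ.ℓ₆ θ.hd' θ.hL' θ.b₀ θ.b₁ Mstar, DecidableEq (geo9Y x).Site] {c35 : ℝ}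
    (a311 M311 : ℝ) (ha311 : 0 < a311) (hM311 : 0 < M311)
    (hΔA : ∀ x : MemberY θ.d₆ θ.ℓ₆ θ.hd' θ.hL' θ.b₀ θ.b₁ Mstar, M311 ≤ (geo9Y x).M → ∀ α₀ : ℝ, 0 < α₀ → (geo9Y x).M * α₀ ≤ a311 →
      ∀ U : (bg9Y (Matrix (Fin N) (Fin N) ℂ) (specialUnitaryUnits (Fin N)) x).Cfg, (bg9Y (Matrix (Fin N) (Fin N) ℂ) (specialUnitaryUnits (Fin N)) x).Reg335 c35 α₀ U →
        PosDefTr (fun _ => (1 : ℝ)) (deltaAY x.toKIdx (parSymY x.toKIdx) (parBY x.toKIdx) (GpY x.toKIdx (parSymY x.toKIdx)) U))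
    (T : ∀ x : MemberY θ.d₆ θ.ℓ₆ θ.hd' θ.hL' θ.b₀ θ.b₁ Mstar, CfgY (Matrix (Fin N) (Fin N) ℂ) x.toKIdx →
      (IBondY x.toKIdx → Matrix (Fin N) (Fin N) ℂ) → (FBondY x.toKIdx → Matrix (Fin N) (Fin N) ℂ))
    (hT : ∃ Mt aT ϑ C : ℝ, 0 < Mt ∧ 0 < aT ∧ ϑ < 1 ∧ 0 < C ∧
      ∀ x : MemberY θ.d₆ θ.ℓ₆ θ.hd' θ.hL' θ.b₀ θ.b₁ Mstar, Mt ≤ (geo9Y x).M → ∀ α₀ : ℝ, 0 < α₀ → (geo9Y x).M * α₀ ≤ aT →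
        ∀ U : (bg9Y (Matrix (Fin N) (Fin N) ℂ) (specialUnitaryUnits (Fin N)) x).Cfg,
          (bg9Y (Matrix (Fin N) (Fin N) ℂ) (specialUnitaryUnits (Fin N)) x).Reg335 c35 α₀ U → (bg9Y (Matrix (Fin N) (Fin N) ℂ) (specialUnitaryUnits (Fin N)) x).Reg336 c35 α₀ U →
            (∀ Ψ : IBondY x.toKIdx → Matrix (Fin N) (Fin N) ℂ,
              (1 - ϑ) * trIP (fun _ => (1 : ℝ)) Ψ Ψ ≤ trIP (fun _ => (1 : ℝ)) (QY x.toKIdx (parBY x.toKIdx) U (T x U Ψ)) (fun y => lamInvY x.toKIdx y • Ψ y)) ∧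
            (∀ Ψ : IBondY x.toKIdx → Matrix (Fin N) (Fin N) ℂ,
              trIP (fun _ => (1 : ℝ)) (T x U Ψ) (deltaAY x.toKIdx (parSymY x.toKIdx) (parBY x.toKIdx) (GpY x.toKIdx (parSymY x.toKIdx)) U (T x U Ψ)) ≤
                C * trIP (fun _ => (1 : ℝ)) Ψ Ψ)) :
    CoerciveUnder c35
      (fun x : MemberY θ.d₆ θ.ℓ₆ θ.hd' θ.hL' θ.b₀ θ.b₁ Mstar => geoComap (geo9Y x) (Prod.fst : (geo9Y x).Site × TrIdx N → (geo9Y x).Site))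
      (bg9Y (Matrix (Fin N) (Fin N) ℂ) (specialUnitaryUnits (Fin N)))
      (fun x U => normMatY (trBasis N) (lamInvY x.toKIdx) (QGQOfY x.toKIdx (parBY x.toKIdx) (lettersYOfRecordV4 N θ Mstar 𝔯 x).GA U)) := by
  obtain ⟨Mt, aT, ϑ, C, hMt, hat, hϑ, hC, hT⟩ := hT
  refine ⟨max M311 Mt, min a311 aT, (1 - ϑ) ^ 2 / (C * dimConstY' (trBasis N)), lt_of_lt_of_le hM311 (le_max_left _ _), lt_min ha311 hat,
    div_pos (by nlinarith) (mul_pos hC (dimConstY'_pos _)), fun x hM α₀ hα₀ hMa U hU hU' => ?_⟩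
  have hpos := hΔA x ((le_max_left _ _).trans hM) α₀ hα₀ (hMa.trans (min_le_left _ _)) U hU
  obtain ⟨hP2, hP1⟩ := hT x ((le_max_right _ _).trans hM) α₀ hα₀ (hMa.trans (min_le_right _ _)) U hU hU'
  have hUG : ∀ μ y, U μ y ∈ specialUnitaryUnits (Fin N) := hU.1.1
  have hsymm : IsSymmTr (fun _ => (1 : ℝ)) (deltaAY x.toKIdx (parSymY x.toKIdx) (parBY x.toKIdx) (GpY x.toKIdx (parSymY x.toKIdx)) U) :=
    deltaAY_isSymmTr x.toKIdx specialUnitaryUnits_le_unitaryUnits (parSymY x.toKIdx) (parBY x.toKIdx) U hUG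
      (fun s s' => parBY_mem x.toKIdx hUG s s') (symm0_parSymY x.toKIdx specialUnitaryUnits_le_unitaryUnits hUG)
      (adj_parSymY x.toKIdx specialUnitaryUnits_le_unitaryUnits hUG)
  have hadj := isAdjTr_QY_QsY_parBY x.toKIdx specialUnitaryUnits_le_unitaryUnits U hUG
  have key := coercive_normMatY_of_testOp (trBasis N) (trBasis_repr_eq_trace N) _ hsymm hpos _ _ hadj (lamInvY x.toKIdx) (T x U)
    hϑ.le hC hP2 hP1
  -- the goal reads the index bonds as `(geo9Y x).Site` with the family's `Fintype ∕ DecidableEq` instances, `key` with the global ones (equal by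
  -- `Subsingleton.elim`, which `convert` discharges); the record's `GA` letter IS `Ring.inverse (Δ_a(U))` over `parSymY ∕ parBY ∕ GpY` and `QGQOfY`
  -- IS the composite `Q ∘ G ∘ Qs` — both by `rfl`
  beta_reduce
  convert key using 3
  all_goals rfl

end Record

end Literature.MathematicalPhysics.QuantumFieldTheory.Balaban1983to89.B9Eq3132CoerciveVariational

end
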